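import Summits.Ventures.PercRepro.MSTightRStarTop

/-!
# The case `u = S` of (R*-M) on a ground set ((F4) of Addendum 37, ground form)

Dossier proofs/MINE1-theoremS.md, Addendum 37 (F4), and proofs/MINE1-RSTARM-PROOF.md §1 (F4), (F6).
The tree's `exists_mem_of_univ` (MSTightRStarTop.lean) proves the case `u = univ` of the
statement (R*-M) on the whole finite type. The inside case (F6) — every member of `T` lies inside
`u` — is the case `u = S` of the RESTRICTED instance on the ground set `u`
(MSTightRestriction.lean), so the statement is needed with an explicit ground set `S : Finset α`:
`L'` a down-set containing every singleton of `S` and not `S`, `T ⊆ 2^S` nonempty with `S ∖ y ∈ L'`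
for every member, at most `|T| + 1` faces, (Sig) and (AO) at `u = S`. Then some member of `T`
lies in `L'` (`exists_mem_of_ground`). The proof is that of `exists_mem_of_univ` with `univ`
replaced by `S`: if no member is in `L'`, (Sig) at `S ∖ y` puts every `S ∖ y` below a member; with
`∅` these are `|T| + 1` faces, hence all the faces; so `T ∪ {S}` is an up-set, every co-singleton
`S ∖ {a}` is a member, and `v₀` lies below one of them.
-/

namespace PercRepro.MSTight

open Finset

variable {α : Type*} [DecidableEq α]

/-- Two subsets of `S` with the same `S`-complement are equal. -/
theorem eq_of_sdiff_eq_of_subset {S y y' : Finset α} (hy : y ⊆ S) (hy' : y' ⊆ S)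
    (h : S \ y = S \ y') : y = y' := by
  rw [← Finset.sdiff_sdiff_eq_self hy, ← Finset.sdiff_sdiff_eq_self hy', h]

/-- **(R*-M), the case `u = S` on a ground set.** -/
theorem exists_mem_of_ground {S : Finset α} {L' T : Finset (Finset α)}
    (hdown : ∀ w ∈ L', ∀ w', w' ⊆ w → w' ∈ L')
    (hsing : ∀ a ∈ S, ({a} : Finset α) ∈ L') (hM : S ∉ L')
    (hne : T.Nonempty) (hTS : ∀ y ∈ T, y ⊆ S) (hTU : ∀ y ∈ T, S \ y ∈ L')
    (hcnt : (faces L' T).card ≤ T.card + 1)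
    (hsig : ∀ v ∈ L', v ⊆ S → S \ v ∈ L' ∨ ∃ y ∈ T, v ⊆ y)
    (hao : ∃ v₀ ∈ L', v₀ ⊆ S ∧ S \ v₀ ∈ L' ∧ ∀ y ∈ T, ¬ v₀ ⊆ y) :
    ∃ y ∈ T, y ∈ L' := by
  by_contra hcon
  push Not at hcon
  obtain ⟨v₀, hv₀, hv₀S, -, hv₀T⟩ := hao
  -- `S` is not a member: `v₀` would lie below it.
  have hMT : S ∉ T := fun h => hv₀T _ h hv₀S
  -- every complement of a member lies below a member
  have hcompl : ∀ y ∈ T, ∃ y' ∈ T, S \ y ⊆ y' := by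
    intro y hy
    rcases hsig _ (hTU y hy) sdiff_subset with h | h
    · rw [Finset.sdiff_sdiff_eq_self (hTS y hy)] at h
      exact absurd h (hcon y hy)
    · exact h
  -- the complements of the members, together with `∅`, are faces
  set Φ : Finset (Finset α) := T.image fun y => S \ y with hΦ
  have hΦsub : insert ∅ Φ ⊆ faces L' T := by
    intro w hw
    rw [mem_insert] at hw
    rcases hw with rfl | hw
    · obtain ⟨y, hy⟩ := hne
      exact mem_faces.2 ⟨hdown _ (hTU y hy) _ (empty_subset _), y, hy, empty_subset _⟩
    · obtain ⟨y, hy, rfl⟩ := mem_image.1 hw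
      exact mem_faces.2 ⟨hTU y hy, hcompl y hy⟩
  have hΦcard : Φ.card = T.card := by
    rw [hΦ]
    apply card_image_of_injOn
    intro y hy y' hy' h
    exact eq_of_sdiff_eq_of_subset (hTS y (mem_coe.1 hy)) (hTS y' (mem_coe.1 hy')) h
  have hemptyΦ : ∅ ∉ Φ := by
    intro h
    obtain ⟨y, hy, hy'⟩ := mem_image.1 h
    have : y = S := Subset.antisymm (hTS y hy) (sdiff_eq_empty_iff_subset.1 hy')
    exact hMT (this ▸ hy)
  have hcard : (insert ∅ Φ).card = T.card + 1 := by
    rw [card_insert_of_notMem hemptyΦ, hΦcard]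
  -- hence these are all the faces
  have hfaces : faces L' T = insert ∅ Φ :=
    (eq_of_subset_of_card_le hΦsub (hcard ▸ hcnt)).symm
  -- `T ∪ {S}` is an up-set inside `S`: adding a point of `S` to a member gives a member or `S`
  have hup : ∀ y ∈ T, ∀ a ∈ S, a ∉ y → insert a y ∈ T ∨ insert a y = S := by
    intro y hy a haS ha
    have h1 : S \ insert a y ∈ faces L' T := by
      obtain ⟨y', hy', hsub⟩ := hcompl y hy
      refine mem_faces.2 ⟨hdown _ (hTU y hy) _
        (sdiff_subset_sdiff (subset_refl _) (subset_insert _ _)), y', hy', ?_⟩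
      exact (sdiff_subset_sdiff (subset_refl _) (subset_insert _ _)).trans hsub
    rw [hfaces, mem_insert] at h1
    rcases h1 with h1 | h1
    · right
      exact Subset.antisymm (insert_subset haS (hTS y hy)) (sdiff_eq_empty_iff_subset.1 h1)
    · left
      obtain ⟨y'', hy'', h2⟩ := mem_image.1 h1
      have : y'' = insert a y :=
        eq_of_sdiff_eq_of_subset (hTS y'' hy'') (insert_subset haS (hTS y hy)) h2
      exact this ▸ hy''
  -- every point of `S` lies in some member
  have hcover : ∀ a ∈ S, ∃ y ∈ T, a ∈ y := by
    intro a haS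
    by_contra hno
    push Not at hno
    obtain ⟨y, hy⟩ := hne
    rcases hup y hy a haS (hno y hy) with h | h
    · exact hno _ h (mem_insert_self _ _)
    · -- `y = S ∖ {a}`, which lies in `L'` by (Sig) at `{a}` (the singleton is below no member)
      have hya : y = S \ {a} := by
        rw [← h, insert_eq, union_sdiff_cancel_left]
        exact disjoint_singleton_left.2 (hno y hy)
      have hsa : S \ {a} ∈ L' := by
        rcases hsig {a} (hsing a haS) (singleton_subset_iff.2 haS) with h' | ⟨y', hy', hsub⟩
        · exact h'
        · exact absurd (hsub (mem_singleton_self a)) (hno y' hy')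
      exact hcon y hy (hya ▸ hsa)
  -- every co-singleton is a member
  have hcosing : ∀ a ∈ S, S \ {a} ∈ T := by
    intro a haS
    obtain ⟨y, hy, hay⟩ := hcover a haS
    have h1 : ({a} : Finset α) ∈ faces L' T :=
      mem_faces.2 ⟨hsing a haS, y, hy, singleton_subset_iff.2 hay⟩
    rw [hfaces, mem_insert] at h1
    rcases h1 with h1 | h1
    · exact absurd h1 (singleton_ne_empty a)
    · obtain ⟨y', hy', h2⟩ := mem_image.1 h1
      have : y' = S \ {a} := by
        rw [← h2, Finset.sdiff_sdiff_eq_self (hTS y' hy')]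
      exact this ▸ hy'
  -- `v₀ ≠ S` lies below the co-singleton of a point of `S` outside it
  have hv₀ne : v₀ ≠ S := fun h => hM (h ▸ hv₀)
  obtain ⟨a, haS, ha⟩ : ∃ a ∈ S, a ∉ v₀ := by
    by_contra hall
    push Not at hall
    exact hv₀ne (Subset.antisymm hv₀S hall)
  exact hv₀T _ (hcosing a haS) (subset_sdiff.2 ⟨hv₀S, disjoint_singleton_right.2 ha⟩)

end PercRepro.MSTight
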